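import Summits.CriticalPhenomena.PercolationContinuityZ3.Theorems.PercNearOneGluingNoHeavyPcintTFibFactor
import Summits.CriticalPhenomena.PercolationContinuityZ3.Theorems.PercNearOneGluingNoHeavyPcintTFibStep
import Summits.CriticalPhenomena.PercolationContinuityZ3.Theorems.PercNearOneGluingNoHeavyPcintVdBEDominating
import HarnessLib

/-!
# PCINT lane, T-fibre route, step (3): the fibre process dominates `π_s` step-wise

Cell `prim-pcint`, seat `prim-pcint-1` (gen 11); memo `run/shared/lean/prim/pcint/T-FIBRE-ROUTE.md` §3–4.

**Theorem (`TFib.dominating`).**  On every finite `Λ ⊆ 𝕋` with root `o`, the fibre oracle `TFib.outF` (root rule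
"fibre of `o` all-open", then "the examined fibre meets the selected fibre"), run with the cluster exploration
`ClusterExpl.rule`, under the product prior `π_p^{⊗(Λ × ZMod m)}` CONDITIONED on the root fibre being all-open (`muF`),
is step-wise dominating for `π_s` (`AdaptDom.Dominating`), provided

* `s ≤ 1 - (1-p)^m` (the root's children: a product law with these marginals), and
* the closed-form tail table holds for every hit size `h ≤ m` and every `1 ≤ j ≤ k ≤ 5` (the other steps: fibre
  factorisation `StepF.fib_mixG_iff`, resampling of the parent fibre, `TFib.typeIneq_of_table`; a non-root parent has
  at most `5` children, `StepF.card_C_le`).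

This discharges hypothesis `hdom` of `AdaptDom.expect_le_of_dominating` for the T-fibre route; the tables for
`(m, p, s) = (3, 0.4335, 0.5001)` and `(5, 0.3815, 0.5001)` are `TFib.table3` / `TFib.table5`.
-/

noncomputable section

namespace Summit.CriticalPhenomena.PercolationContinuityZ3.Theorems.Pcint

namespace TFib

open Finset AdaptDom ClusterExpl Literature.Probability.Percolation Literature.Probability.LatticeModels

variable {m : ℕ} [NeZero m] {Λ : Finset (Site 2)} (enc : ↥Λ → ℕ) (o : ↥Λ) (p : ℝ)

/-! ### The weight: product prior conditioned on the root fibre being all-open -/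

/-- **The weight of the T-fibre route**: the product prior `π_p` on fibre states, conditioned on the fibre of the root
being all-open. -/
def muF (w : ↥Λ → (ZMod m → Bool)) : ℝ :=
  pw (fun _ => wt p) w * (if w o = allOpen m then 1 else 0) / wt p (allOpen m)

/-- `π_p(allOpen) = p^m`. -/
theorem wt_allOpen : wt p (allOpen m) = p ^ m := by
  unfold wt allOpen bern
  simp only [if_true, prod_const, card_univ, card_zmod]

variable {o p}

/-- `π_p(allOpen) > 0` for `p > 0`. -/
theorem wt_allOpen_pos (hp : 0 < p) : 0 < wt p (allOpen m) := by rw [wt_allOpen]; positivity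

/-- `muF ≥ 0`. -/
theorem muF_nonneg (hp0 : 0 ≤ p) (hp1 : p ≤ 1) (hp : 0 < p) (w : ↥Λ → (ZMod m → Bool)) : 0 ≤ muF o p w :=
  div_nonneg (mul_nonneg (pw_nonneg (fun _ s => wt_nonneg hp0 hp1 s) w) (by split_ifs <;> norm_num))
    (wt_allOpen_pos hp).le

/-- `muF` is a probability. -/
theorem sum_muF (hp : 0 < p) : ∑ w : ↥Λ → (ZMod m → Bool), muF o p w = 1 := by
  unfold muF
  rw [← Finset.sum_div]
  have h := sum_pw_mul_blind (fun (_ : ↥Λ) => wt p) (fun _ => sum_wt p) o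
    (fun x => if x = allOpen m then (1 : ℝ) else 0) (fun _ => 1) (fun _ _ => rfl)
  simp only [mul_one] at h
  rw [h, sum_pw (fun _ => sum_wt p), mul_one]
  have : ∑ x : ZMod m → Bool, wt p x * (if x = allOpen m then (1 : ℝ) else 0) = wt p (allOpen m) := by
    rw [Finset.sum_eq_single (allOpen m) (fun x _ hx => by rw [if_neg hx, mul_zero]) (by simp)]; simp
  rw [this, div_self (wt_allOpen_pos hp).ne']

/-- `muF ≤ pw / p^m`. -/
theorem muF_le_pw (hp0 : 0 ≤ p) (hp1 : p ≤ 1) (hp : 0 < p) (w : ↥Λ → (ZMod m → Bool)) :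
    muF o p w ≤ pw (fun _ => wt p) w / wt p (allOpen m) := by
  unfold muF
  refine div_le_div_of_nonneg_right ?_ (wt_allOpen_pos hp).le
  have h0 : 0 ≤ pw (fun _ => wt p) w := pw_nonneg (fun _ s => wt_nonneg hp0 hp1 s) w
  split_ifs <;> nlinarith

variable (o) in
/-- On the fibre of a state of step `n ≥ 1`, the root factor of `muF` is the constant `[σ o = tt]`. -/
theorem root_factor_of_fib {n : ℕ} (hn : 0 < n) {σ : ↥Λ → Option Bool} {w : ↥Λ → (ZMod m → Bool)}
    (h : Fib enc o m n σ w) :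
    (if w o = allOpen m then (1 : ℝ) else 0) = if (σ o).getD false = true then 1 else 0 := by
  have h0 := h 0 hn o (root_mem_rule_zero enc o σ)
  rw [outF_init w (show ∀ v, traj enc o σ 0 v = none from fun _ => rfl)] at h0
  by_cases hw : w o = allOpen m
  · rw [if_pos hw, if_pos]; rw [← h0]; exact decide_eq_true hw
  · rw [if_neg hw, if_neg]; rw [← h0]; simp [hw]

open Classical in
variable (o) in
/-- Fibre sums of `muF` at a step `n ≥ 1`: the root factor is constant on the fibre. -/
theorem sum_fib_muF {n : ℕ} (hn : 0 < n) {σ : ↥Λ → Option Bool} (hcons : traj enc o σ n = σ)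
    (F : (↥Λ → (ZMod m → Bool)) → ℝ) :
    ∑ w ∈ univ.filter (fun w => run (rule (boxGraphT Λ) enc o) (outF m Λ enc w) n = σ), muF o p w * F w =
      (if (σ o).getD false = true then (1 : ℝ) else 0) / wt p (allOpen m) *
        ∑ w, pw (fun _ => wt p) w * ((if Fib enc o m n σ w then (1 : ℝ) else 0) * F w) := by
  classical
  rw [Finset.sum_filter, Finset.mul_sum]
  refine Finset.sum_congr rfl fun w _ => ?_
  by_cases h : Fib enc o m n σ w
  · rw [if_pos ((run_eq_iff_fib enc o n σ w).2 ⟨hcons, h⟩), if_pos h, muF, root_factor_of_fib enc o hn h]; ring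
  · rw [if_neg (fun h' => h ((run_eq_iff_fib enc o n σ w).1 h').2), if_neg h]; ring

/-! ### The `u`-integral of a general step: resampling the parent fibre -/

/-- **The one-step law, integrated**: with `H = w d` and the children pattern `a ↦ meet (u c) (u a)`,
`Σ_u pw(u) [meet H (u c)] g(pattern) = Σ_x π_p(x) [meet H x] · E_{π_{1-(1-p)^{#x}}}[g]`. -/
theorem sum_pw_meet_pattern (H : ZMod m → Bool) (c : ↥Λ) (C : Finset ↥Λ) (hc : c ∉ C)
    {g : (↥Λ → Bool) → ℝ} (hg : StepTest C g) :
    ∑ u : ↥Λ → (ZMod m → Bool), pw (fun _ => wt p) u *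
        ((if meet m H (u c) = true then (1 : ℝ) else 0) * g (fun a => if a ∈ C then meet m (u c) (u a) else false)) =
      ∑ x : ZMod m → Bool, wt p x * (if meet m H x = true then (1 : ℝ) else 0) *
        ∑ ω : ↥Λ → Bool, wt (1 - (1 - p) ^ (trueSet x).card) ω * g ω := by
  rw [sum_pw_resample (fun _ => wt p) (fun _ => sum_wt p) c]
  have e1 : ∀ (u : ↥Λ → (ZMod m → Bool)) (x : ZMod m → Bool),
      (if meet m H (Function.update u c x c) = true then (1 : ℝ) else 0) *
        g (fun a => if a ∈ C then meet m (Function.update u c x c) (Function.update u c x a) else false) =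
      (if meet m H x = true then (1 : ℝ) else 0) * g (fun a => if a ∈ C then meet m x (u a) else false) := by
    intro u x
    rw [Function.update_self]
    congr 1
    refine hg.2 _ _ fun a ha => ?_
    have hac : a ≠ c := fun h => hc (h ▸ ha)
    rw [Function.update_of_ne hac]
  simp_rw [e1]
  -- swap the sums
  rw [show (∑ u : ↥Λ → (ZMod m → Bool), pw (fun _ => wt p) u * ∑ x, wt p x *
      ((if meet m H x = true then (1 : ℝ) else 0) * g (fun a => if a ∈ C then meet m x (u a) else false))) =
      ∑ x, wt p x * (if meet m H x = true then (1 : ℝ) else 0) *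
        ∑ u : ↥Λ → (ZMod m → Bool), pw (fun _ => wt p) u * g (fun a => if a ∈ C then meet m x (u a) else false) by
    simp_rw [Finset.mul_sum]; rw [Finset.sum_comm]
    exact Finset.sum_congr rfl fun x _ => Finset.sum_congr rfl fun u _ => by ring]
  refine Finset.sum_congr rfl fun x _ => ?_
  rw [sum_pw_pat_eq_sum_wt (wt p) (sum_wt p) (1 - (1 - p) ^ (trueSet x).card) (fun _ s => meet m x s) C
    (fun a _ => sum_wt_filter_meet p x) g hg]

/-- The same with `g ≡ 1`: `Σ_u pw(u) [meet H (u c)] = Σ_x π_p(x) [meet H x]`. -/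
theorem sum_pw_meet (H : ZMod m → Bool) (c : ↥Λ) :
    ∑ u : ↥Λ → (ZMod m → Bool), pw (fun _ => wt p) u * (if meet m H (u c) = true then (1 : ℝ) else 0) =
      ∑ x : ZMod m → Bool, wt p x * (if meet m H x = true then (1 : ℝ) else 0) := by
  have h := sum_pw_mul_blind (fun (_ : ↥Λ) => wt p) (fun _ => sum_wt p) c
    (fun x => if meet m H x = true then (1 : ℝ) else 0) (fun _ => 1) (fun _ _ => rfl)
  simp only [mul_one] at h
  rw [h, sum_pw (fun _ => sum_wt p), mul_one]

/-! ### The theorem -/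

/-- **The fibre process dominates `π_s` step-wise** (hypothesis `hdom` of `AdaptDom.expect_le_of_dominating`), given
the root marginal inequality and the tail table. -/
theorem dominating (hp0 : 0 < p) (hp1 : p ≤ 1) {s : ℝ} (hs0 : 0 ≤ s) (hs1 : s ≤ 1)
    (hroot : s ≤ 1 - (1 - p) ^ m)
    (htable : ∀ h, h ≤ m → ∀ k, 1 ≤ k → k ≤ 5 → ∀ j, 1 ≤ j → j ≤ k →
      (∑ u ∈ range (m + 1), (((m.choose u : ℕ) : ℝ) - ((m - h).choose u : ℕ)) * (p ^ u * (1 - p) ^ (m - u) * 1)) *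
          binTail k s j ≤
        ∑ u ∈ range (m + 1), (((m.choose u : ℕ) : ℝ) - ((m - h).choose u : ℕ)) *
          (p ^ u * (1 - p) ^ (m - u) * binTail k (1 - (1 - p) ^ u) j)) :
    Dominating s (rule (boxGraphT Λ) enc o) (muF o p) (outF m Λ enc) := by
  classical
  have hp0' : 0 ≤ p := hp0.le
  intro n σ g hg
  have hwt1 : ∑ ω : ↥Λ → Bool, wt s ω = 1 := sum_wt _
  rcases Nat.eq_zero_or_pos n with rfl | hn
  · -- the root step
    by_cases hσ : σ = fun _ => none
    · subst hσ
      have hR : rule (boxGraphT Λ) enc o (fun _ => none) = {o} := by rw [rule, if_pos (fun _ => rfl)]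
      have hfib : (univ.filter fun w : ↥Λ → (ZMod m → Bool) =>
          run (rule (boxGraphT Λ) enc o) (outF m Λ enc w) 0 = fun _ => none) = univ := by ext w; simp [run]
      rw [hfib, sum_muF hp0, one_mul]
      have hle : ∀ ω : ↥Λ → Bool, g ω ≤ g (fun _ => true) := fun ω => hg.1 _ _ fun v _ => Bool.le_true _
      have hval : ∀ w : ↥Λ → (ZMod m → Bool), muF o p w * g (outF m Λ enc w (fun _ => none)) =
          muF o p w * g (fun _ => true) := by
        intro w
        by_cases hw : w o = allOpen m
        · refine congrArg _ (hg.2 _ _ fun v hv => ?_)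
          rw [hR, Finset.mem_singleton] at hv; subst hv
          rw [outF_init w (fun _ => rfl)]; exact decide_eq_true hw
        · simp [muF, hw]
      rw [Finset.sum_congr rfl fun w _ => hval w, ← Finset.sum_mul, sum_muF hp0, one_mul]
      calc ∑ ω : ↥Λ → Bool, wt s ω * g ω ≤ ∑ ω : ↥Λ → Bool, wt s ω * g (fun _ => true) :=
            Finset.sum_le_sum fun ω _ => mul_le_mul_of_nonneg_left (hle ω) (wt_nonneg hs0 hs1 ω)
        _ = g (fun _ => true) := by rw [← Finset.sum_mul, hwt1, one_mul]
    · have hfib : (univ.filter fun w : ↥Λ → (ZMod m → Bool) =>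
          run (rule (boxGraphT Λ) enc o) (outF m Λ enc w) 0 = σ) = ∅ := by
        ext w; simp only [Finset.mem_filter, Finset.mem_univ, true_and, Finset.notMem_empty, iff_false]
        exact fun h => hσ (h ▸ rfl)
      rw [hfib]; simp
  -- a genuine step
  by_cases hcons : traj enc o σ n = σ
  swap
  · have hfib : (univ.filter fun w : ↥Λ → (ZMod m → Bool) =>
        run (rule (boxGraphT Λ) enc o) (outF m Λ enc w) n = σ) = ∅ := by
      ext w; simp only [Finset.mem_filter, Finset.mem_univ, true_and, Finset.notMem_empty, iff_false]
      exact fun h => hcons ((run_eq_iff_fib enc o n σ w).1 h).1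
    rw [hfib]; simp
  have hne : ¬ ∀ v, σ v = none := by
    obtain ⟨n', rfl⟩ := Nat.exists_eq_add_of_le' hn; rw [← hcons]
    exact not_initial_run_succ (boxGraphT Λ) enc o (readOut σ) n'
  rw [show (∑ w ∈ univ.filter (fun w => run (rule (boxGraphT Λ) enc o) (outF m Λ enc w) n = σ), muF o p w) =
      ∑ w ∈ univ.filter (fun w => run (rule (boxGraphT Λ) enc o) (outF m Λ enc w) n = σ), muF o p w * 1 by
    simp only [mul_one]]
  rw [sum_fib_muF enc o hn hcons (fun _ => 1), sum_fib_muF enc o hn hcons]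
  simp only [mul_one]
  rw [mul_assoc]
  refine mul_le_mul_of_nonneg_left ?_ (div_nonneg (by split_ifs <;> norm_num) (wt_allOpen_pos hp0).le)
  cases hsel : sel (boxGraphT Λ) enc σ with
  | none =>
    have hR := rule_eq_empty_of_sel_eq_none (boxGraphT Λ) enc o hne hsel
    have hc : ∀ x : ↥Λ → Bool, g x = g (fun _ => false) := fun x => hg.2 _ _ fun v hv => by
      rw [hR] at hv; exact absurd hv (by simp)
    have e1 : ∑ ω : ↥Λ → Bool, wt s ω * g ω = g (fun _ => false) := by
      rw [Finset.sum_congr rfl fun ω _ => by rw [hc ω], ← Finset.sum_mul, hwt1, one_mul]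
    rw [e1, Finset.sum_mul]
    refine le_of_eq (Finset.sum_congr rfl fun w _ => ?_)
    rw [hc (outF m Λ enc w σ)]; ring
  | some c =>
    by_cases hco : c = o
    · -- the origin step: product law with marginals `1 - (1-p)^m ≥ s`
      rw [hco] at hsel
      set W := insert o (rule (boxGraphT Λ) enc o σ)
      have hK : ∀ u w : ↥Λ → (ZMod m → Bool), u o = allOpen m → g (outF m Λ enc (mixG W u w) σ) =
          g (fun a => if a ∈ rule (boxGraphT Λ) enc o σ then meet m (allOpen m) (u a) else false) :=
        fun u w huo => out_origin_mixG hsel u w hg huo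
      refine dominance_of_factorisation (fun _ => wt p) (fun _ => sum_wt p) (fun _ x => wt_nonneg hp0' hp1 x) W
        (Fib enc o m n σ) _ (fun u _ => u o = allOpen m) (fib_origin_mixG_iff hcons hsel) _ _ hK _ fun w => ?_
      -- integrate out the root coordinate
      have hoC : o ∉ rule (boxGraphT Λ) enc o σ := fun h =>
        absurd (rule_unrevealed (boxGraphT Λ) enc o σ o h) (by rw [(sel_revealedTrue (boxGraphT Λ) enc hsel).1]; simp)
      have hblind : ∀ (u : ↥Λ → (ZMod m → Bool)) (x : ZMod m → Bool),
          g (fun a => if a ∈ rule (boxGraphT Λ) enc o σ then meet m (allOpen m) (Function.update u o x a) else false) =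
          g (fun a => if a ∈ rule (boxGraphT Λ) enc o σ then meet m (allOpen m) (u a) else false) := by
        intro u x
        refine hg.2 _ _ fun a ha => ?_
        have hao : a ≠ o := fun h => hoC (h ▸ ha)
        rw [Function.update_of_ne hao]
      have h1 := sum_pw_mul_blind (fun (_ : ↥Λ) => wt p) (fun _ => sum_wt p) o
        (fun x => if x = allOpen m then (1 : ℝ) else 0)
        (fun u => g (fun a => if a ∈ rule (boxGraphT Λ) enc o σ then meet m (allOpen m) (u a) else false)) hblind
      have h2 := sum_pw_mul_blind (fun (_ : ↥Λ) => wt p) (fun _ => sum_wt p) o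
        (fun x => if x = allOpen m then (1 : ℝ) else 0) (fun _ => (1 : ℝ)) (fun _ _ => rfl)
      simp only [mul_one] at h2
      rw [h1, h2, sum_pw (fun _ => sum_wt p), mul_one]
      refine mul_le_mul_of_nonneg_left ?_ (Finset.sum_nonneg fun x _ =>
        mul_nonneg (wt_nonneg hp0' hp1 x) (by split_ifs <;> norm_num))
      refine sum_wt_le_sum_pw_pat (wt p) (fun x => wt_nonneg hp0' hp1 x) (sum_wt p) hs0 hs1
        (fun _ x => meet m (allOpen m) x) _ (fun a _ => ?_) g hg
      rw [sum_wt_filter_meet p (allOpen m)]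
      have : (trueSet (allOpen m)).card = m := by
        unfold trueSet allOpen; simp
      rw [this]; exact hroot
    · -- a general step: the examiner `d` of `c`
      have hcn : traj enc o σ n c ≠ none := by
        rw [hcons, (sel_revealedTrue (boxGraphT Λ) enc hsel).1]; simp
      obtain ⟨k₀, hk₀, d, hne₀, hseld, -, hcR, -⟩ := exists_examiner (boxGraphT Λ) enc o (readOut σ) hcn hco
      let X : StepF (Λ := Λ) enc o m := ⟨n, σ, c, k₀, d, hcons, hsel, hco, hk₀, hne₀, hseld, hcR⟩
      refine dominance_of_factorisation (fun _ => wt p) (fun _ => sum_wt p) (fun _ x => wt_nonneg hp0' hp1 x) X.W₀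
        (Fib enc o m n σ) X.FibRest (fun u w => meet m (w X.d) (u X.c) = true) X.fib_mixG_iff _
        (fun u => g (fun a => if a ∈ X.C then meet m (u X.c) (u a) else false))
        (fun u w _ => X.out_mixG u w hg) _ fun w => ?_
      have hcC : X.c ∉ X.C := fun h => absurd (X.mem_C h).1 (by rw [X.σ_c]; simp)
      rw [sum_pw_meet, sum_pw_meet_pattern (w X.d) X.c X.C hcC hg]
      refine typeIneq_of_table p s (w X.d) X.C (fun j hj1 hjk => ?_) hg
      have hk5 : X.C.card ≤ 5 := X.card_C_le
      have hh : (trueSet (w X.d)).card ≤ m := by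
        have := card_le_univ (trueSet (w X.d)); rwa [card_zmod] at this
      exact htable _ hh X.C.card (hj1.trans hjk) hk5 j hj1 hjk

end TFib

end Summit.CriticalPhenomena.PercolationContinuityZ3.Theorems.Pcint

end
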